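import Summits.Ventures.PercRepro.RankLevelSetBiIndepParallel
import Summits.Ventures.PercRepro.RankLevelSetBiIndepPF2

/-! # RankLevelSetBiIndepLRParallel — THE PARALLEL-PAIR REDUCTION OF THE LIKELIHOOD-RATIO MONOTONICITY (LR):
(LR) TOO REDUCES TO SIMPLE MATROIDS (night-1 g26; dossier §38.10)

THEOREM (`biIndepLR_of_parallel`): let `{y, z}` be a parallel pair of `M` and `N := M ／ {y} ＼ {z}`. If `N`
satisfies (LR) (`BiIndepLR`, all-pairs form) and its profile is PF₂ (`BiIndepPF2`), then `M` satisfies (LR).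
PROOF (the counting identities of `RankLevelSetBiIndepParallel`): at `y' ∉ {y, z}` both marked counts of `M` at level
`j + 1` are twice those of `N` at level `j` (`ncard_mem_eq_two_mul`, `ncard_notMem_eq_two_mul`) and the level-`0`
counts vanish, so the TP2 inequalities transfer with the factor `4`; at `y` (and at `z`) the counts are
`a_j(M; y) = D_j(N)` and `b_j(M; y) = D_{j−1}(N)` (`b_0 = 0`), so (LR) at `y` is `D_{p−1} D_q ≤ D_p D_{q−1}` for
`1 ≤ p ≤ q` — the PF₂ spread inequality of the profile of `N`. With `biIndepPF2_of_ULC`: the same under the named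
Lorentzian fact `BiIndepULC N` (`biIndepLR_of_parallel_of_ULC`). Together with `biIndepLR_disjointSum` and the
loop/coloop cases (direct sums with `U_{0,1}` / `U_{1,1}`) the question «(LR) for every finite matroid» reduces to
SIMPLE matroids, exactly as (★★) does (`biIndepPerElem_of_parallel`). Nothing here asserts (LR), PF₂ or ULC;
every declaration has a docstring; imports: the cell's own modules and Mathlib only. Axioms: standard. -/

namespace PercRepro

open Set Matroid

variable {α : Type} (M : Matroid α) [M.Finite]

/-- **The through-`y` count of `M` is the profile of `N`**: `a_j(M; y) = D_j(N)` for a parallel pair `{y, z}`. -/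
lemma yThroughCount_parallel_left {y z : α} (h : ParallelPair M y z) (j : ℕ) :
    yThroughCount M y j = biIndepCount (M ／ {y} ＼ {z}) j := by
  unfold yThroughCount
  have e1 : {Q ∈ biIndep M (j + 1) | y ∈ Q} = {Q ∈ biIndep M (j + 1) | y ∈ Q ∧ y ∈ Q} := by
    ext Q; simp only [Set.mem_setOf_eq, and_self]
  rw [e1, ncard_biIndep_mem_left_eq M h j (fun Q => y ∈ Q)]
  unfold biIndepCount
  congr 1
  ext T
  simp only [Set.mem_setOf_eq, Set.mem_insert_iff, true_or, and_true]

/-- **The through-`z` count of `M` is the profile of `N`**: `a_j(M; z) = D_j(N)`. -/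
lemma yThroughCount_parallel_right {y z : α} (h : ParallelPair M y z) (j : ℕ) :
    yThroughCount M z j = biIndepCount (M ／ {y} ＼ {z}) j := by
  unfold yThroughCount
  have e1 : {Q ∈ biIndep M (j + 1) | z ∈ Q} = {Q ∈ biIndep M (j + 1) | z ∈ Q ∧ z ∈ Q} := by
    ext Q; simp only [Set.mem_setOf_eq, and_self]
  rw [e1, ncard_biIndep_mem_right_eq M h j (fun Q => z ∈ Q)]
  unfold biIndepCount
  congr 1
  ext T
  simp only [Set.mem_setOf_eq, Set.mem_insert_iff, true_or, and_true]

omit [M.Finite] in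
/-- No bi-independent set of `N = M ／ {y} ＼ {z}` meets the pair. -/
lemma notMem_of_mem_biIndep_contract_delete (y z : α) {r : ℕ} {T : Set α}
    (hT : T ∈ biIndep (M ／ {y} ＼ {z}) r) : y ∉ T ∧ z ∉ T := by
  have hTE := hT.1
  rw [ground_contract_delete] at hTE
  exact ⟨fun hx => (hTE hx).2 (Set.mem_insert y _), fun hx => (hTE hx).2 (Set.mem_insert_of_mem y rfl)⟩

/-- **The avoid-`y` count of `M` is the profile of `N` one level down**: `b_{j+1}(M; y) = D_j(N)`. -/
lemma yAvoidCount_parallel_left {y z : α} (h : ParallelPair M y z) (j : ℕ) :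
    yAvoidCount M y (j + 1) = biIndepCount (M ／ {y} ＼ {z}) j := by
  unfold yAvoidCount
  have e1 : {Z ∈ biIndep M (j + 1) | y ∉ Z} = {Z ∈ biIndep M (j + 1) | z ∈ Z ∧ y ∉ Z} := by
    ext Z
    simp only [Set.mem_setOf_eq]
    constructor
    · rintro ⟨hZ, hyZ⟩
      exact ⟨hZ, (biIndep_mem_or M h hZ).resolve_left hyZ, hyZ⟩
    · rintro ⟨hZ, -, hyZ⟩; exact ⟨hZ, hyZ⟩
  rw [e1, ncard_biIndep_mem_right_eq M h j (fun Z => y ∉ Z)]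
  unfold biIndepCount
  congr 1
  ext T
  simp only [Set.mem_setOf_eq, Set.mem_insert_iff, not_or, and_iff_left_iff_imp]
  intro hT
  exact ⟨h.1, (notMem_of_mem_biIndep_contract_delete M y z hT).1⟩

/-- **The avoid-`z` count of `M` is the profile of `N` one level down**: `b_{j+1}(M; z) = D_j(N)`. -/
lemma yAvoidCount_parallel_right {y z : α} (h : ParallelPair M y z) (j : ℕ) :
    yAvoidCount M z (j + 1) = biIndepCount (M ／ {y} ＼ {z}) j := by
  unfold yAvoidCount
  have e1 : {Z ∈ biIndep M (j + 1) | z ∉ Z} = {Z ∈ biIndep M (j + 1) | y ∈ Z ∧ z ∉ Z} := by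
    ext Z
    simp only [Set.mem_setOf_eq]
    constructor
    · rintro ⟨hZ, hzZ⟩
      exact ⟨hZ, (biIndep_mem_or M h hZ).resolve_right hzZ, hzZ⟩
    · rintro ⟨hZ, -, hzZ⟩; exact ⟨hZ, hzZ⟩
  rw [e1, ncard_biIndep_mem_left_eq M h j (fun Z => z ∉ Z)]
  unfold biIndepCount
  congr 1
  ext T
  simp only [Set.mem_setOf_eq, Set.mem_insert_iff, not_or, and_iff_left_iff_imp]
  intro hT
  exact ⟨h.1.symm, (notMem_of_mem_biIndep_contract_delete M y z hT).2⟩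

/-- With a parallel pair there is no bi-independent `0`-set, so every avoid count at level `0` vanishes. -/
lemma yAvoidCount_zero_of_parallel {y z : α} (h : ParallelPair M y z) (y' : α) : yAvoidCount M y' 0 = 0 := by
  unfold yAvoidCount
  rw [biIndep_zero_eq_empty M h]
  simp

/-- **The PF₂ step at a pair of levels**: `D_{p−1} · D_q ≤ D_p · D_{q−1}` for `1 ≤ p ≤ q`. -/
lemma pf2_step {N : Matroid α} [N.Finite] (hN : BiIndepPF2 N) {p q : ℕ} (hp : 1 ≤ p) (hpq : p ≤ q) :
    biIndepCount N q * biIndepCount N (p - 1) ≤ biIndepCount N p * biIndepCount N (q - 1) := by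
  rcases Nat.lt_or_ge p q with hlt | hge
  · have := hN p (q - 1) 1 (by omega) hp
    rw [show q - 1 + 1 = q by omega] at this
    calc biIndepCount N q * biIndepCount N (p - 1) = biIndepCount N (p - 1) * biIndepCount N q := by ring
      _ ≤ biIndepCount N p * biIndepCount N (q - 1) := this
  · have : p = q := le_antisymm hpq hge
    subst this
    exact le_of_eq (by ring)

/-- **(LR) at an element of the pair**: `(LR)(M; y)` from the PF₂ profile of `N`. -/
lemma biIndepLR_parallel_at_left {y z : α} (h : ParallelPair M y z) (hN2 : BiIndepPF2 (M ／ {y} ＼ {z}))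
    {p q : ℕ} (hpq : p ≤ q) :
    yThroughCount M y q * yAvoidCount M y p ≤ yThroughCount M y p * yAvoidCount M y q := by
  cases p with
  | zero => rw [yAvoidCount_zero_of_parallel M h, mul_zero]; exact Nat.zero_le _
  | succ p' =>
    obtain ⟨q', rfl⟩ : ∃ q', q = q' + 1 := ⟨q - 1, by omega⟩
    rw [yThroughCount_parallel_left M h, yThroughCount_parallel_left M h, yAvoidCount_parallel_left M h,
      yAvoidCount_parallel_left M h]
    have := pf2_step hN2 (p := p' + 1) (q := q' + 1) (by omega) hpq
    simpa using this

/-- **(LR) at the other element of the pair**: `(LR)(M; z)` from the PF₂ profile of `N`. -/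
lemma biIndepLR_parallel_at_right {y z : α} (h : ParallelPair M y z) (hN2 : BiIndepPF2 (M ／ {y} ＼ {z}))
    {p q : ℕ} (hpq : p ≤ q) :
    yThroughCount M z q * yAvoidCount M z p ≤ yThroughCount M z p * yAvoidCount M z q := by
  cases p with
  | zero => rw [yAvoidCount_zero_of_parallel M h, mul_zero]; exact Nat.zero_le _
  | succ p' =>
    obtain ⟨q', rfl⟩ : ∃ q', q = q' + 1 := ⟨q - 1, by omega⟩
    rw [yThroughCount_parallel_right M h, yThroughCount_parallel_right M h, yAvoidCount_parallel_right M h,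
      yAvoidCount_parallel_right M h]
    have := pf2_step hN2 (p := p' + 1) (q := q' + 1) (by omega) hpq
    simpa using this

/-- **(LR) at an element outside the pair**: both counts double, so (LR) transfers from `N` to `M`. -/
lemma biIndepLR_parallel_at_other {y z y' : α} (h : ParallelPair M y z) (hyy : y' ≠ y) (hyz : y' ≠ z)
    (hy'M : y' ∈ M.E) (hN : BiIndepLR (M ／ {y} ＼ {z})) {p q : ℕ} (hpq : p ≤ q) :
    yThroughCount M y' q * yAvoidCount M y' p ≤ yThroughCount M y' p * yAvoidCount M y' q := by
  have hy'N : y' ∈ (M ／ {y} ＼ {z}).E := by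
    rw [ground_contract_delete]
    exact ⟨hy'M, by simp only [Set.mem_insert_iff, Set.mem_singleton_iff, not_or]; exact ⟨hyy, hyz⟩⟩
  cases p with
  | zero => rw [yAvoidCount_zero_of_parallel M h, mul_zero]; exact Nat.zero_le _
  | succ p' =>
    obtain ⟨q', rfl⟩ : ∃ q', q = q' + 1 := ⟨q - 1, by omega⟩
    have hT : ∀ j, yThroughCount M y' (j + 1) = 2 * yThroughCount (M ／ {y} ＼ {z}) y' j := by
      intro j
      unfold yThroughCount
      exact ncard_mem_eq_two_mul M h hyy hyz (j + 1)
    have hA : ∀ j, yAvoidCount M y' (j + 1) = 2 * yAvoidCount (M ／ {y} ＼ {z}) y' j := by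
      intro j
      unfold yAvoidCount
      exact ncard_notMem_eq_two_mul M h hyy hyz j
    rw [hT, hT, hA, hA]
    have := hN y' hy'N p' q' (by omega)
    nlinarith [this]

/-- **THE REDUCTION**: for a parallel pair `{y, z}` with `N = M ／ {y} ＼ {z}`, `BiIndepLR N → BiIndepPF2 N →
BiIndepLR M`. -/
theorem biIndepLR_of_parallel {y z : α} (h : ParallelPair M y z) (hN : BiIndepLR (M ／ {y} ＼ {z}))
    (hN2 : BiIndepPF2 (M ／ {y} ＼ {z})) : BiIndepLR M := by
  intro y' hy' p q hpq
  by_cases hyy : y' = y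
  · subst hyy; exact biIndepLR_parallel_at_left M h hN2 hpq
  · by_cases hyz : y' = z
    · subst hyz; exact biIndepLR_parallel_at_right M h hN2 hpq
    · exact biIndepLR_parallel_at_other M h hyy hyz hy' hN hpq

/-- **The reduction under the named Lorentzian fact**: `BiIndepLR N → BiIndepULC N → BiIndepLR M`. -/
theorem biIndepLR_of_parallel_of_ULC {y z : α} (h : ParallelPair M y z) (hN : BiIndepLR (M ／ {y} ＼ {z}))
    (hN2 : BiIndepULC (M ／ {y} ＼ {z})) : BiIndepLR M :=
  biIndepLR_of_parallel M h hN (biIndepPF2_of_ULC _ hN2)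

end PercRepro
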